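import Summits.BirchSwinnertonDyer.BirchSwinnertonDyer.Theorems.GenusKolyvaginAtTwoShaCardDvdPowAtTwoRTOnCut
import Summits.BirchSwinnertonDyer.BirchSwinnertonDyer.Theorems.GenusKolyvaginAtTwoPowDvdShaCardAtTwoRT
import HarnessLib

/-!
# Route `GenusKolyvaginAtTwo`, crux Q3R_T `EquivariantKolyvaginExactAtTwoRT` (stmt-BirchSwinnertonDyer-23657 = U_T 23658 ∧ L_T 23659) —
# KOLYVAGIN'S EXACT FORMULA AT 2 ON THE CUT: `#Ш(E/K)[2^∞] = 2^(2M₀)` on the route's live configuration, SORRY-FREE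

Seat `bsd-line-gk2-p1` g19 (LEAD, cell `bsd-f1-sign2`), `--supports stmt-BirchSwinnertonDyer-23658` (helper; closes nothing: Q3R_T / U_T as filed
carry no cut hypotheses).  THEOREMS ONLY.  BSD is NOT proved by any of this.

* `natCard_primaryComponent_sha_two_eq_pow_onCut` — `Nat.dvd_antisymm` of U_T on the cut (`…RTOnCut.shaCardDvdPowAtTwoRT_onCut`, LINE 19) and
  the closed L_T (`Theorems.powDvdShaCardAtTwoRT_proof`, p744020).

References: [McCallumLMS1991] §5; [Kolyvagin1990] Thm. A; [GrossLMS1991] §5; [Kramer1981] Thm. 1.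
-/

set_option autoImplicit false
-- the Theorems namespace of this sub repeats the summit name by design (D-0017 nested layout)
set_option linter.dupNamespace false

noncomputable section

open scoped Classical

namespace Summit.BirchSwinnertonDyer.BirchSwinnertonDyer.Theorems.GenusExact.RationalPairDescent

open WeierstrassCurve NumberField IsDedekindDomain Field Literature.NumberTheory.EllipticCurves
  Literature.NumberTheory.GaloisRepresentations Literature.NumberTheory.EllipticCurves.ModularForms
open Literature.NumberTheory
open Summit.BirchSwinnertonDyer.BirchSwinnertonDyer.Theses.GenusKolyvaginAtTwo
open Summit.BirchSwinnertonDyer.BirchSwinnertonDyer.Theorems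
open Summit.BirchSwinnertonDyer.BirchSwinnertonDyer.Theorems.GenusExact.PlusDescent

/-- **KOLYVAGIN'S EXACT FORMULA AT 2 ON THE CUT: `#Ш(E/K)[2^∞] = 2^(2M₀)`** — Q3R_T's conclusion (`EquivariantKolyvaginExactAtTwoRT`) on the
route's live configuration, SORRY-FREE: Q3R_T's binders verbatim with the cut (`w(E) = 1`, a globally minimal 2-Selmer-minimal twin model
`Wd ≅ E^{(d_K)}` with `ord₂ c(Wd) ≤ 1`) inserted after the divisibility clause of `M₀`.  `Nat.dvd_antisymm` of the upper half on the cut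
(`shaCardDvdPowAtTwoRT_onCut`: PAIRCOUNT gk2-p4 g22 × SANDWICH′ this seat × `#X = 4^t` gk2-p5) and the CLOSED lower half L_T
(`Theorems.powDvdShaCardAtTwoRT_proof`, gk2-p4 g21, p744020).  This is the statement a restated Q3R_T′ (glue 23243 re-typed on the cut) is closed
by.  Q3R_T / U_T AS FILED are NOT proved (off the cut nothing is claimed); BSD is NOT proved by any of this.
[cite: McCallumLMS1991, §5 Thm. 5.4, Cor. 5.6, Thm. 5.8] [cite: Kolyvagin1990, Thm. A] [cite: GrossLMS1991, §5] -/
theorem natCard_primaryComponent_sha_two_eq_pow_onCut :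
  KolyvaginRelationAtTwo → EquivariantChebotarevAtTwoR → (∀ (W : WeierstrassCurve ℚ) [W.IsElliptic], W.Δ < 0 → ∀ (c₀ : Field.absoluteGaloisGroup ℚ), Literature.NumberTheory.GaloisRepresentations.IsComplexConjugation (Rat.castHom ℝ) c₀ → ∀ (M : ℕ), ∃ P : W.geomTorsion ((2 ^ M : ℕ) : ℤ), ∀ Q : W.geomTorsion ((2 ^ M : ℕ) : ℤ), ∃ a b : ℤ, Q = a • P + b • (c₀ • P)) → ∀ (W : WeierstrassCurve ℚ) [W.IsElliptic] [W.IsGloballyMinimal] [NeZero (W.conductorNorm ℤ)], ¬ W.HasCM → Odd W.tamagawaProduct → ∀ (v : IsDedekindDomain.HeightOneSpectrum (NumberField.RingOfIntegers ℚ)), ((2 : ℕ) : NumberField.RingOfIntegers ℚ) ∉ v.asIdeal → ((W.conductorNorm ℤ : ℕ) : NumberField.RingOfIntegers ℚ) ∈ v.asIdeal → W.HasMultiplicativeReductionAt v → W.Δ < 0 → ∀ (K : Type) [Field K] [NumberField K], Literature.NumberTheory.EllipticCurves.IsImaginaryQuadratic K → Odd (NumberField.discr K) → NumberField.discr K ≠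 -3 → Literature.NumberTheory.EllipticCurves.SatisfiesHeegnerHypothesis (W.conductorNorm ℤ) K → ¬ IsSquare ((NumberField.discr K : ℚ) * -|W.Δ|) → ¬ IsSquare ((NumberField.discr K : ℚ) * (-(2 * |W.Δ|))) → (∀ n : ℕ, 0 < n → W.HasSurjectiveModNGaloisRep ((2 : ℤ) ^ n)) → ∀ (Dt : Literature.NumberTheory.EllipticCurves.ModularForms.ModularParametrizationData W (W.conductorNorm ℤ)) (β : ℤ) (ι : K →+* ℂ) (d₁ : Literature.NumberTheory.EllipticCurves.KolyvaginHeegnerData Dt β ι 1), ¬ IsOfFinAddOrder d₁.derivedPoint → ∀ (M₀ : ℕ), (∃ Q : (W.baseChange (Literature.NumberTheory.EllipticCurves.ringClassField K ι 1)).toAffine.Point, ((2 ^ M₀ : ℕ) : ℤ) • Q = d₁.derivedPoint) → (¬ ∃ Q : (W.baseChange (Literature.NumberTheory.EllipticCurves.ringClassField K ι 1)).toAffine.Point, ((2 ^ (M₀ + 1) : ℕ) : ℤ) • Q = d₁.derivedPoint) →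
      W.rootNumber = 1 → ∀ (Wd : WeierstrassCurve ℚ) [Wd.IsElliptic] [Wd.IsGloballyMinimal],
        (∃ C : WeierstrassCurve.VariableChange ℚ, C • W.quadraticTwist (NumberField.discr K : ℚ) = Wd) →
        Nat.card (Wd.selmerGroup 2) = 2 → padicValNat 2 Wd.tamagawaProduct ≤ 1 →
      ∀ (n : ℕ) (d : Literature.NumberTheory.EllipticCurves.KolyvaginHeegnerData Dt β ι n), Squarefree n → (∀ ℓ ∈ n.primeFactors, Literature.NumberTheory.EllipticCurves.Zhang2014.IsKolyvaginPrime (W.conductorNorm ℤ) W K 2 ℓ ∧ 2 ≤ Literature.NumberTheory.EllipticCurves.Zhang2014.kolyvaginIndex W 2 ℓ ∧ Literature.NumberTheory.EllipticCurves.FrobEqFrobInfty W K 2 ℓ) → (¬ ∃ Q : (W.baseChange (Literature.NumberTheory.EllipticCurves.ringClassField K ι n)).toAffine.Point, (2 : ℤ) • Q = d.derivedPoint) → Nat.card (AddCommGroup.primaryComponent (W.baseChange K).sha 2) = 2 ^ (2 * M₀) := by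
  intro hQ2 hQ5R hQ1 W _ _ _ hcm hT v h2v hNv hmult hneg K _ _ hIQ hodd h3 hHe hsq1 hsq2 hρ Dt β ι d₁ hy M₀ hdiv hndiv hw Wd _ _ hWd hSel hDEF
    n d hn hKoly hPn
  exact Nat.dvd_antisymm
    (shaCardDvdPowAtTwoRT_onCut hQ2 hQ5R hQ1 W hcm hT v h2v hNv hmult hneg K hIQ hodd h3 hHe hsq1 hsq2 hρ Dt β ι d₁ hy M₀ hdiv hndiv hw Wd
      hWd hSel hDEF)
    (powDvdShaCardAtTwoRT_proof hQ2 hQ5R hQ1 W hcm hT v h2v hNv hmult hneg K hIQ hodd h3 hHe hsq1 hsq2 hρ Dt β ι d₁ hy M₀ hdiv hndiv n d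
      hn hKoly hPn)

end Summit.BirchSwinnertonDyer.BirchSwinnertonDyer.Theorems.GenusExact.RationalPairDescent

end
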